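import Summits.QuantumFields.QCD.Theorems.HeatSlicedQuarksInterleavedHeatSliceFlowStubColumnIdentificationAux

/-!
# Stub `stub_columnSmoothing` of line `Sketch` (crux `InterleavedHeatSliceFlow`, item stmt-QuantumFields-8891)

**Column smoothing** (reshape r7, sliced Gram bound): for every complex square matrix `A`, every `σ > 0` and
every index `η`, the `ℓ²` norm of the column `η` of the smoothed adjoint `K(σ) Aᴴ`, `K(σ) = exp(-σ AᴴA)`,
satisfies

`Σ_ζ |(K(σ) Aᴴ)(ζ,η)|² ≤ (eσ)⁻¹ · Re K'(σ)(η,η)`, where `K'(σ) = exp(-σ AAᴴ)`.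

## Proof

Semigroup property `K(σ) = K(σ/2) K(σ/2)` (`Matrix.exp_add_of_commute`) and the landed intertwining
`K(σ/2) Aᴴ = Aᴴ K'(σ/2)` (`exp_conjTranspose_mul_self_mul_conjTranspose`) give
`K(σ) Aᴴ = (K(σ/2) Aᴴ) K'(σ/2)`, so column `η` of `K(σ) Aᴴ` is the matrix `K(σ/2) Aᴴ` applied to column `η`
of `K'(σ/2)`.  The landed `adjoint_smoothing` at time `σ/2` bounds its `ℓ²` norm squared by
`(2e·σ/2)⁻¹ = (eσ)⁻¹` times `Σ_ζ |K'(σ/2)(ζ,η)|²`, and the latter is `Re K'(σ)(η,η)` by the landed T*T identity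
for columns `sum_norm_sq_col_eq_re_apply_self` applied to the matrix `Aᴴ` (whose `(Aᴴ)ᴴ Aᴴ` is `A Aᴴ`).
Generic finite-dimensional linear algebra; no named facts are used.
-/

noncomputable section

namespace Summit.QuantumFields.QCD.Cruxes.InterleavedHeatSliceFlow.Sketch

open scoped Matrix ComplexConjugate

variable {ι : Type} [Fintype ι] [DecidableEq ι]

/-- The heat kernel at time `σ` is the square of the heat kernel at time `σ/2`
(`exp (X + X) = exp X * exp X` for the commuting pair `X, X`). -/
theorem exp_neg_smul_eq_mul_self_half (H : Matrix ι ι ℂ) (σ : ℝ) :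
    NormedSpace.exp (-(σ : ℂ) • H) =
      NormedSpace.exp (-((σ / 2 : ℝ) : ℂ) • H) * NormedSpace.exp (-((σ / 2 : ℝ) : ℂ) • H) := by
  set X : Matrix ι ι ℂ := -((σ / 2 : ℝ) : ℂ) • H with hX
  have hsum : -(σ : ℂ) • H = X + X := by
    rw [hX, ← add_smul]; congr 1; push_cast; ring
  rw [hsum, Matrix.exp_add_of_commute X X (Commute.refl X)]

/-- **Factorisation of the smoothed adjoint**: `exp(-σ AᴴA) Aᴴ = (exp(-(σ/2) AᴴA) Aᴴ) · exp(-(σ/2) AAᴴ)`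
(semigroup property at `σ = σ/2 + σ/2` followed by the intertwining of `Aᴴ` through the second factor). -/
theorem exp_mul_conjTranspose_eq_half_mul_half (A : Matrix ι ι ℂ) (σ : ℝ) :
    NormedSpace.exp (-(σ : ℂ) • (Aᴴ * A)) * Aᴴ =
      NormedSpace.exp (-((σ / 2 : ℝ) : ℂ) • (Aᴴ * A)) * Aᴴ *
        NormedSpace.exp (-((σ / 2 : ℝ) : ℂ) • (A * Aᴴ)) := by
  rw [exp_neg_smul_eq_mul_self_half (Aᴴ * A) σ, Matrix.mul_assoc, Matrix.mul_assoc,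
    exp_conjTranspose_mul_self_mul_conjTranspose A (σ / 2)]

omit [DecidableEq ι] in
/-- A column of a product is the left factor applied to the corresponding column of the right factor:
`(M N)(ζ,η) = (M · col_η N)(ζ)`. -/
theorem mul_apply_eq_mulVec_col (M N : Matrix ι ι ℂ) (ζ η : ι) :
    (M * N) ζ η = M.mulVec (fun κ => N κ η) ζ := by
  simp [Matrix.mul_apply, Matrix.mulVec, dotProduct]

/-- **Column smoothing** (pointwise form): for `σ > 0` and every index `η`,
`Σ_ζ |(exp(-σAᴴA) Aᴴ)(ζ,η)|² ≤ (eσ)⁻¹ · Re exp(-σAAᴴ)(η,η)`. -/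
theorem column_smoothing (A : Matrix ι ι ℂ) {σ : ℝ} (hσ : 0 < σ) (η : ι) :
    ∑ ζ, ‖(NormedSpace.exp (-(σ : ℂ) • (Aᴴ * A)) * Aᴴ) ζ η‖ ^ 2 ≤
      (Real.exp 1 * σ)⁻¹ * ((NormedSpace.exp (-(σ : ℂ) • (A * Aᴴ))) η η).re := by
  have hσ2 : 0 < σ / 2 := by positivity
  -- T*T for the columns of `exp(-(σ/2) AAᴴ)`, i.e. of the heat kernel of the matrix `Aᴴ`
  have hT := sum_norm_sq_col_eq_re_apply_self Aᴴ (σ / 2) η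
  rw [Matrix.conjTranspose_conjTranspose] at hT
  have h2 : (2 * (σ / 2) : ℝ) = σ := by ring
  rw [h2] at hT
  -- adjoint smoothing at time `σ/2` applied to the column `η` of `exp(-(σ/2) AAᴴ)`
  have hS := adjoint_smoothing A hσ2 (fun κ => (NormedSpace.exp (-((σ / 2 : ℝ) : ℂ) • (A * Aᴴ))) κ η)
  rw [hT] at hS
  have hcoef : (2 * Real.exp 1 * (σ / 2))⁻¹ = (Real.exp 1 * σ)⁻¹ := by
    congr 1; ring
  rw [hcoef] at hS
  rw [exp_mul_conjTranspose_eq_half_mul_half A σ]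
  simpa only [mul_apply_eq_mulVec_col] using hS

/-- **Registered form (stub `stub_columnSmoothing` of the crux item)**: the `ℓ²` norm of a COLUMN of the smoothed
adjoint, `Σ_ζ |(e^{−σAᴴA} Aᴴ)(ζ,η)|² ≤ (eσ)⁻¹ · Re e^{−σAAᴴ}(η,η)` for `σ > 0` (`column_smoothing`). -/
theorem stub_columnSmoothing :
    ∀ (ι : Type) [Fintype ι] [DecidableEq ι] (A : Matrix ι ι ℂ) (σ : ℝ), 0 < σ → ∀ (η : ι),
      ∑ ζ, ‖(NormedSpace.exp (-(σ : ℂ) • (Aᴴ * A)) * Aᴴ) ζ η‖ ^ 2 ≤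
        (Real.exp 1 * σ)⁻¹ * ((NormedSpace.exp (-(σ : ℂ) • (A * Aᴴ))) η η).re :=
  fun _ _ _ A _ hσ η => column_smoothing A hσ η

end Summit.QuantumFields.QCD.Cruxes.InterleavedHeatSliceFlow.Sketch

end
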